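import Literature.AlgebraicGeometry.Modules.AffineLocalizing
import Mathlib.AlgebraicGeometry.IdealSheaf.Basic
import Mathlib.Algebra.Module.Torsion.Basic
import HarnessLib

/-!
# [OURS · L1 W4.5(b) · EL♮(3) · F-88♭ brick 1] The annihilator ideal sheaf `Ann(σ) ⊆ 𝒪_X` of a global section of a
# quasi-coherent (affine-localizing) `𝒪_X`-module

Crux chain w45b (cell `res-hironaka`, slot W4.5(b)), working crux **EL♮** = stmt-ResolutionOfSingularities-20038, child **EL♮(3)** =
stmt-ResolutionOfSingularities-20148, route EquisingularLift, line `sections`. Written by res-type-027 g23 as brick 1 of **F-88♭**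
(= the PRINCIPAL-IDEAL case of the registered NEED-FACT stub `stub_elnat_grothendieckExistence : GrothendieckExistence.{0}` AS A
THEOREM; INPUTS ADDENDUM 8 §2 option (A), res-inputs-crit-1 R176/R186). HONEST FRAMING: OURS — elementary sheaf bookkeeping, nothing of
H. Hironaka's 2017 manuscript is involved, nothing is attributed to it; AI-written, gate-checked, weaker than expert review. No `sorry`;
standard axioms; ONE definition (`annIdeal`, an `IdealSheafData` — data, not a `Prop`). `--supports stmt-ResolutionOfSingularities-20148 --as helper`.

WHAT. For a sheaf of `𝒪_X`-modules `F` which is affine-localizing (`Modules/AffineLocalizing`: numerators and torsion on basic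
opens — every quasi-coherent module is) and a global section `σ ∈ Γ(X, F)`, the ideals
`Ann(σ|_U) = {r ∈ Γ(U, 𝒪_X) | r • σ|_U = 0}` (Mathlib `Ideal.torsionOf`) on the affine opens `U` form a quasi-coherent ideal sheaf
(Mathlib `Scheme.IdealSheafData`): `Ann(σ|_{D(g)}) = Ann(σ|_U) · Γ(D(g), 𝒪_X)` (`torsionOf_map_basicOpen`: a section `r'/gⁿ` killing
`σ|_{D(g)}` has `(r σ|_U)|_{D(g)} = 0`, hence `gᵐ r σ|_U = 0` by the torsion property). USE (brick 2, `…NatGEPrincipalIdeals`): for an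
epimorphism `v : 𝒪_X ↠ F` onto a coherent module, `Ann(v(1))` is the ideal sheaf of the closed subscheme "`Spec` of the quotient
`𝒪_X/ker v ≅ F`" — the algebraization of a closed formal subscheme in Grothendieck's existence theorem (EGA III₁ 5.1.8 / GW II 24.109).

References (method / index only): A. Grothendieck, J. Dieudonné, EGA I (1960), (9.1); U. Görtz, T. Wedhorn, *Algebraic Geometry I* (2nd ed.
2020), Prop. 7.14, (7.15); R. Hartshorne, *Algebraic Geometry* (1977), II Lemma 5.3, Ex. 5.6.
-/

set_option linter.dupNamespace false -- mandated namespace `Summit.<Summit>.<Problem>` of this single-conjunct summit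

noncomputable section

-- `TopCat.Presheaf`/`Scheme.Modules` are not reducible (as in Mathlib's `AlgebraicGeometry/Modules`).
set_option backward.isDefEq.respectTransparency false

open CategoryTheory CategoryTheory.Limits AlgebraicGeometry TopologicalSpace Opposite
open Literature.AlgebraicGeometry.Modules

universe u

namespace Summit.ResolutionOfSingularities.ResolutionOfSingularities.Cruxes.EquisingularLiftNat.Sections

namespace GEPrincipal

variable {X : Scheme.{u}}

/-! ### The annihilator ideal sheaf of a global section -/

section AnnIdeal

variable {F : X.Modules} (hF : IsAffineLocalizing F) (σ : Γ(F, ⊤))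

/-- Restriction of the global section `σ` to an open `U`. [folklore] -/
abbrev resSec (U : X.Opens) : Γ(F, U) := F.presheaf.map (homOfLE (le_top : U ≤ ⊤)).op σ

/-- Restriction is transitive on `σ`. [folklore] -/
theorem map_resSec {U V : X.Opens} (h : V ≤ U) :
    F.presheaf.map (homOfLE h).op (resSec σ U) = resSec σ V := by
  change (F.presheaf.map _ ≫ F.presheaf.map _) σ = _
  rw [← Functor.map_comp]
  rfl

include hF in
/-- **The annihilator of a global section `σ` of an affine-localizing `𝒪_X`-module is a quasi-coherent
ideal sheaf**: `U ↦ Ann(σ|_U) = {r ∈ Γ(U, 𝒪_X) | r • σ|_U = 0}` satisfies `Ann(σ|_{D(g)}) = Ann(σ|_U)_g`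
(numerators and torsion on the basic open `D(g)`). [folklore] -/
theorem torsionOf_map_basicOpen (U : X.affineOpens) (g : Γ(X, U)) :
    (Ideal.torsionOf Γ(X, U) Γ(F, U) (resSec σ U)).map
        (X.presheaf.map (homOfLE <| X.basicOpen_le g).op).hom =
      Ideal.torsionOf Γ(X, X.basicOpen g) Γ(F, X.basicOpen g) (resSec σ (X.basicOpen g)) := by
  haveI := U.2.isLocalization_basicOpen g
  apply le_antisymm
  · rw [Ideal.map_le_iff_le_comap]
    intro r hr
    rw [Ideal.mem_comap, Ideal.mem_torsionOf_iff, ← map_resSec σ (X.basicOpen_le g),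
      ← Scheme.Modules.map_smul, (Ideal.mem_torsionOf_iff _ _).mp hr, map_zero]
  · intro r' hr'
    rw [Ideal.mem_torsionOf_iff] at hr'
    obtain ⟨⟨r, ⟨_, n, rfl⟩⟩, hx⟩ :=
      IsLocalization.surj (Submonoid.powers g) (S := Γ(X, X.basicOpen g)) r'
    -- `res r • σ|_D = 0`
    have hres : X.presheaf.map (homOfLE (X.basicOpen_le g)).op r • resSec σ (X.basicOpen g) = 0 := by
      have : X.presheaf.map (homOfLE (X.basicOpen_le g)).op r =
          r' * X.presheaf.map (homOfLE (X.basicOpen_le g)).op (g ^ n) := hx.symm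
      rw [this, mul_comm, mul_smul, hr', smul_zero]
    -- hence `(r • σ|_U)|_D = 0`, so `gᵐ r • σ|_U = 0`
    have h0 : F.presheaf.map (homOfLE (X.basicOpen_le g)).op (r • resSec σ U) = 0 := by
      rw [Scheme.Modules.map_smul, map_resSec, hres]
    obtain ⟨m, hm⟩ := hF.torsion U.2 g (r • resSec σ U) (X.basicOpen_le g) le_rfl h0
    rw [smul_smul] at hm
    have hmem : g ^ m * r ∈ Ideal.torsionOf Γ(X, U) Γ(F, U) (resSec σ U) :=
      (Ideal.mem_torsionOf_iff _ _).mpr hm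
    -- `r' = res (gᵐ r) / g^{n+m}`
    have hu : IsUnit (X.presheaf.map (homOfLE (X.basicOpen_le g)).op (g ^ (n + m))) :=
      IsLocalization.map_units (M := Submonoid.powers g) Γ(X, X.basicOpen g) ⟨g ^ (n + m), n + m, rfl⟩
    obtain ⟨u, hu'⟩ := hu
    have hr' : r' = X.presheaf.map (homOfLE (X.basicOpen_le g)).op (g ^ m * r) * ↑u⁻¹ := by
      rw [Units.eq_mul_inv_iff_mul_eq, hu', pow_add, map_mul, map_mul]
      have hx' : r' * X.presheaf.map (homOfLE (X.basicOpen_le g)).op (g ^ n) =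
          X.presheaf.map (homOfLE (X.basicOpen_le g)).op r := hx
      rw [← hx']
      ring
    rw [hr']
    exact Ideal.mul_mem_right _ _ (Ideal.mem_map_of_mem _ hmem)

/-- **The annihilator ideal sheaf `Ann(σ) ⊆ 𝒪_X` of a global section `σ`** of an affine-localizing `𝒪_X`-module:
`Ann(σ)(U) = {r ∈ Γ(U, 𝒪_X) | r • σ|_U = 0}` on affine opens `U` (a quasi-coherent ideal sheaf by `torsionOf_map_basicOpen`).
[OURS · F-88♭ brick 1] [folklore] -/
def annIdeal : X.IdealSheafData where
  ideal U := Ideal.torsionOf Γ(X, U) Γ(F, U) (resSec σ U)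
  map_ideal_basicOpen U g := torsionOf_map_basicOpen hF σ U g

/-- Membership in `Ann(σ)(U)`: `r • σ|_U = 0`. [folklore] -/
theorem mem_annIdeal_iff (U : X.affineOpens) (r : Γ(X, U)) :
    r ∈ (annIdeal hF σ).ideal U ↔ r • resSec σ U = 0 :=
  Ideal.mem_torsionOf_iff _ _

end AnnIdeal

end GEPrincipal

end Summit.ResolutionOfSingularities.ResolutionOfSingularities.Cruxes.EquisingularLiftNat.Sections

end
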